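import Summits.BirchSwinnertonDyer.Rank1Residual.Additive.X3BranchResidualCountOfCharacterFacts
import HarnessLib

/-!
# X3: the residual-count evaluation `hn` from the twisted character facts with the characters of
# `Φ₀` and `W[p]/Φ₀` SUPPLIED (display form) — `p^{a+b} = #H¹(ℚ_Σ/ℚ_∞, Φ₀)·#U` for an explicit
# primitive `φ` acting on `Φ₀` and an explicit primitive `ψ` acting on `W[p]/Φ₀`
# (cell `bsd-eis`, seat `bsd-eis-x3` gen 3; route K1 `AdditiveBranchIMC` — supports only)

HONEST FRAMING (cell `bsd-eis`, `run/shared/lean/pub/bsd-eis/README.md` §4): THEOREMS ONLY; nothing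
booked. `X3BranchResidualCountOfCharacterFacts.lean` states the per-pair analytic certificates
`hCcert`/`hDcert` for EVERY primitive Dirichlet character acting as the character of `Φ₀` (resp. of
`W[p]/Φ₀`) — there is exactly one, but a per-pair display then owes a uniqueness argument. This file
is the DISPLAY FORM: the display SUPPLIES its characters `φ` (mod `m`) and `ψ` (mod `d`) together with
the proof that they act on `Φ₀` / on `W[p]` modulo `Φ₀` (at `p = 3`: the quadratic characters of the
Hesse-type line certificate, bsd-addord's `KernelDisc.exists_isRationalLine_kernelChar_of_cert`), and
the certificates concern THOSE characters only: `∀ g, IsCharacterLFunctionC p φ Σ₀ g → ord_T(ḡ) = a`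
(`g` is unique; with `GreenbergVatsal2000/CharacterLambdaCertificateProofs.lean` this is `a + 1`
`p`-adic valuations of explicit generalized-Bernoulli sums).

* `smul_sub_eq_of_forall_mem` — the action on the transported line read from the action on `Φ₀`;
* `X3Branch.residualCount_eq_pow_of_charFacts_of_characters`, `X3Branch.eval_of_charFacts_of_characters`
  (the `hn` of `X3BranchCertificateRoad*.lean` §3 / of g2's `lamEqW_*_of_eval`).

References: [GreenbergVatsal2000] §2 pp. 28–29, §3 pp. 41–43.
-/

set_option autoImplicit false

noncomputable section

open scoped Classical

namespace Summit.BirchSwinnertonDyer.Rank1Residual.Additive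

open NumberField IsDedekindDomain Field Rat.HeightOneSpectrum WeierstrassCurve
  Literature.NumberTheory.GaloisRepresentations Literature.NumberTheory.EllipticCurves
  Literature.NumberTheory.EllipticCurves.GreenbergVatsal2000
  Literature.NumberTheory.EllipticCurves.Rank1Residual
  Summit.BirchSwinnertonDyer.Rank1Residual.X2.ResidualDevissageModules
  Summit.BirchSwinnertonDyer.Rank1Residual.X2.ResidualDevissageLine
  Summit.BirchSwinnertonDyer.Rank1Residual.X2.PrimeOrderCharacters
  Summit.BirchSwinnertonDyer.Rank1Residual.X2.ResidualLineCharacters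

variable {W : WeierstrassCurve ℚ} [W.IsElliptic] {p : ℕ} [hp : Fact p.Prime]
  {Φ₀ : AddSubgroup (geomTorsion W (p : ℤ))} (hΦ : IsRationalLine W p Φ₀)

omit [W.IsElliptic] in
/-- The action of `σ` on the transported line `(lineSub Φ₀ hΦ).Sub` read from its action on `Φ₀`:
if `σ • P = n • P` for all `P ∈ Φ₀` then `σ` acts as `n` on the transported line. [folklore] -/
theorem X3Branch.smul_sub_eq_of_forall_mem {σ : absoluteGaloisGroup ℚ} {n : ℕ}
    (h : ∀ P ∈ Φ₀, σ • P = n • P) (x : (lineSub Φ₀ hΦ).Sub) : σ • x = n • x := by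
  apply (lineSub Φ₀ hΦ).incl_injective
  obtain ⟨P, hP, hPx⟩ : (lineSub Φ₀ hΦ).incl x ∈ Φ₀.map (X2.ResidualDevissageLine.torsionToPrimary W p) := x.2
  rw [StableSubgroup.incl_smul, map_nsmul, ← hPx, ← X2.ResidualDevissageLine.torsionToPrimary_smul, h P hP,
    map_nsmul]

include hΦ in
/-- **GV's residual count EVALUATED, display form**: as
`X3Branch.residualCount_eq_pow_of_charFacts`, but with the characters SUPPLIED — `φ` primitive mod `m`
acting on `Φ₀` (`hφ0`), `ψ` primitive mod `d` acting on `W[p]` modulo `Φ₀` (`hψ0`) — and the two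
analytic certificates stated for these characters only. Parity (`φ` even, `ψ` odd) follows from
`LineEven`, `φ ≠ 1` and `ψ ≠ ω` from the non-trivial action (`φψ = χ_p`), conductor support from
Néron–Ogg–Shafarevich; then the twisted character facts give `p^{a+b} = #H¹(ℚ_Σ/ℚ_∞, Φ₀)·#U`.
[cite: GreenbergVatsal2000, §2 pp. 28–29 (Props. (2.6), (2.8)) and §3 pp. 41–43] -/
theorem X3Branch.residualCount_eq_pow_of_charFacts_of_characters
    (hC : characterLFunctionC_hasUnitContent_and_order_eq_card_of_ne_one)
    (hD : characterLFunctionD_hasUnitContent_and_order_eq_card_of_ne_teichmuller)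
    (hp2 : p ≠ 2) (S₀ : Finset (HeightOneSpectrum (𝓞 ℚ)))
    (hS₀ : ∀ v ∈ S₀, ((p : ℕ) : 𝓞 ℚ) ∉ v.asIdeal)
    (hS : ∀ v : HeightOneSpectrum (𝓞 ℚ), v ∉ S₀ → ((p : ℕ) : 𝓞 ℚ) ∉ v.asIdeal →
      W.HasGoodReductionAt v)
    (heven : LineEven W p Φ₀)
    (hnt : ∃ (σ : absoluteGaloisGroup ℚ) (P : geomTorsion W (p : ℤ)), P ∈ Φ₀ ∧ σ • P ≠ P)
    {m : ℕ} [NeZero m] (φ : DirichletCharacter (ZMod p) m) (hφprim : φ.IsPrimitive)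
    (hφ0 : ∀ (σ : absoluteGaloisGroup ℚ), ∀ P ∈ Φ₀,
      σ • P = (φ ((modNCyclotomicCharacter ℚ m σ : (ZMod m)ˣ) : ZMod m)).val • P)
    {d : ℕ} [NeZero d] (ψ : DirichletCharacter (ZMod p) d) (hψprim : ψ.IsPrimitive)
    (hψ0 : ∀ (σ : absoluteGaloisGroup ℚ) (P : geomTorsion W (p : ℤ)),
      σ • P - (ψ ((modNCyclotomicCharacter ℚ d σ : (ZMod d)ˣ) : ZMod d)).val • P ∈ Φ₀)
    {a b : ℕ}
    (hCcert : ∀ g : IwasawaAlgebra p, IsCharacterLFunctionC p φ S₀ g →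
      (PowerSeries.map (PadicInt.toZMod (p := p)) g).order.toNat = a)
    (hDcert : ∀ g : IwasawaAlgebra p, IsCharacterLFunctionD p ψ S₀ g →
      (PowerSeries.map (PadicInt.toZMod (p := p)) g).order.toNat = b)
    (κ : ZpExtension ℚ p) (hκ : κ.IsCyclotomic) :
    p ^ (a + b) =
      Nat.card (residualLineH1 W p κ S₀ Φ₀ hΦ) * Nat.card (residualQuotSelmer W p κ S₀ Φ₀ hΦ) := by
  -- the actions on the transported line and on its quotient
  have hφA : ∀ (σ : absoluteGaloisGroup ℚ) (x : (lineSub Φ₀ hΦ).Sub),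
      σ • x = (φ ((modNCyclotomicCharacter ℚ m σ : (ZMod m)ˣ) : ZMod m)).val • x :=
    fun σ x ↦ X3Branch.smul_sub_eq_of_forall_mem hΦ (hφ0 σ) x
  have hψQ : ∀ (σ : absoluteGaloisGroup ℚ) (y : (lineSub Φ₀ hΦ).Quot),
      σ • y = (ψ ((modNCyclotomicCharacter ℚ d σ : (ZMod d)ˣ) : ZMod d)).val • y :=
    fun σ y ↦ smul_quot_eq_of_forall_mem hΦ (hψ0 σ) y
  have hφeven : φ.Even := even_of_lineEven hΦ heven hφA
  have hψodd : ψ.Odd := odd_of_lineEven hΦ hp2 heven hψQ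
  have hφ1 : φ ≠ 1 := X3Branch.character_sub_ne_one_of_exists_smul_ne hnt hφ0
  have hψω : ∃ c : ℕ, c.Coprime (d * p) ∧ ψ (c : ZMod d) ≠ (c : ZMod p) :=
    X3Branch.exists_coprime_apply_ne_of_exists_smul_ne hΦ hnt hφ0 hψ0
  have hSm : ∀ ℓ : ℕ, ℓ.Prime → ℓ ∣ m → ℓ ≠ p → ∃ v ∈ S₀, ((ℓ : ℕ) : 𝓞 ℚ) ∈ v.asIdeal :=
    fun ℓ hℓ hℓm hℓp ↦ exists_mem_of_dvd_level_sub hΦ hS hφprim hφA hℓ hℓm hℓp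
  have hSd : ∀ ℓ : ℕ, ℓ.Prime → ℓ ∣ d → ℓ ≠ p → ∃ v ∈ S₀, ((ℓ : ℕ) : 𝓞 ℚ) ∈ v.asIdeal :=
    fun ℓ hℓ hℓd hℓp ↦ X3Branch.exists_mem_of_dvd_level_quot_of_ne hΦ hS hψprim hψQ hℓ hℓd hℓp
  -- the character `p`-adic `L`-functions and the character identities at the twist
  obtain ⟨gC, hgC⟩ := exists_isCharacterLFunctionC_of_ne_one p φ S₀ hp2 hφ1
  obtain ⟨gD, hgD⟩ := exists_isCharacterLFunctionD_of_exists_ne p ψ S₀ hp2 hψω hS₀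
  obtain ⟨-, hCcard⟩ := hC p κ m φ S₀ (lineSub Φ₀ hΦ).Sub hp2 hφprim hφeven hφ1 hκ hS₀ hSm
    (natCard_sub_eq hΦ) hφA gC hgC
  obtain ⟨-, hDcard⟩ := hD p κ d ψ S₀ (lineSub Φ₀ hΦ).Quot hp2 hψprim hψodd hψω hκ hS₀ hSd
    (natCard_quot_eq hΦ) hψQ gD hgD
  rw [hCcert gC hgC] at hCcard
  rw [hDcert gD hgD] at hDcard
  change p ^ (a + b) =
    Nat.card (unramifiedOutside κ.kerSubgroup (lineSub Φ₀ hΦ).Sub p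
        (↑S₀ : Set (HeightOneSpectrum (𝓞 ℚ)))) *
      Nat.card (unramifiedSelmer κ.kerSubgroup (lineSub Φ₀ hΦ).Quot p
        (↑S₀ : Set (HeightOneSpectrum (𝓞 ℚ))))
  rw [pow_add, hCcard, hDcard]

include hΦ in
/-- **The displayed `hn` of the certificate road, display form**: from the supplied characters, their
two `λ`-certificates and `a + b = n + Σ_{v∈Σ₀} δ_v(W)`, for every cyclotomic `κ`:
`p^{n + Σδ} = #residualLineH1 · #residualQuotSelmer` — the input `hn` of
`X3Branch.lamEqW_mult_of_facts_of_lifting_of_eval` / `X3Branch.lamEqW_of_facts[_of_lifting]_of_eval`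
(gen 2) and of the degenerate-free end states. [cite: GreenbergVatsal2000, §3 p. 43 and §2 Cor. (2.3), Prop. (2.4)] -/
theorem X3Branch.eval_of_charFacts_of_characters
    (hC : characterLFunctionC_hasUnitContent_and_order_eq_card_of_ne_one)
    (hD : characterLFunctionD_hasUnitContent_and_order_eq_card_of_ne_teichmuller)
    (hp2 : p ≠ 2) (S₀ : Finset (HeightOneSpectrum (𝓞 ℚ)))
    (hS₀ : ∀ v ∈ S₀, ((p : ℕ) : 𝓞 ℚ) ∉ v.asIdeal)
    (hS : ∀ v : HeightOneSpectrum (𝓞 ℚ), v ∉ S₀ → ((p : ℕ) : 𝓞 ℚ) ∉ v.asIdeal →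
      W.HasGoodReductionAt v)
    (heven : LineEven W p Φ₀)
    (hnt : ∃ (σ : absoluteGaloisGroup ℚ) (P : geomTorsion W (p : ℤ)), P ∈ Φ₀ ∧ σ • P ≠ P)
    {m : ℕ} [NeZero m] (φ : DirichletCharacter (ZMod p) m) (hφprim : φ.IsPrimitive)
    (hφ0 : ∀ (σ : absoluteGaloisGroup ℚ), ∀ P ∈ Φ₀,
      σ • P = (φ ((modNCyclotomicCharacter ℚ m σ : (ZMod m)ˣ) : ZMod m)).val • P)
    {d : ℕ} [NeZero d] (ψ : DirichletCharacter (ZMod p) d) (hψprim : ψ.IsPrimitive)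
    (hψ0 : ∀ (σ : absoluteGaloisGroup ℚ) (P : geomTorsion W (p : ℤ)),
      σ • P - (ψ ((modNCyclotomicCharacter ℚ d σ : (ZMod d)ˣ) : ZMod d)).val • P ∈ Φ₀)
    {a b n : ℕ} (hab : a + b = n + ∑ v ∈ S₀, delta W p v)
    (hCcert : ∀ g : IwasawaAlgebra p, IsCharacterLFunctionC p φ S₀ g →
      (PowerSeries.map (PadicInt.toZMod (p := p)) g).order.toNat = a)
    (hDcert : ∀ g : IwasawaAlgebra p, IsCharacterLFunctionD p ψ S₀ g →
      (PowerSeries.map (PadicInt.toZMod (p := p)) g).order.toNat = b)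
    (κ : ZpExtension ℚ p) (hκ : κ.IsCyclotomic) :
    p ^ (n + ∑ v ∈ S₀, delta W p v) =
      Nat.card (residualLineH1 W p κ S₀ Φ₀ hΦ) * Nat.card (residualQuotSelmer W p κ S₀ Φ₀ hΦ) := by
  rw [← hab]
  exact X3Branch.residualCount_eq_pow_of_charFacts_of_characters hΦ hC hD hp2 S₀ hS₀ hS heven hnt φ
    hφprim hφ0 ψ hψprim hψ0 hCcert hDcert κ hκ

end Summit.BirchSwinnertonDyer.Rank1Residual.Additive

end
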